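import Mathlib
import Literature.Computability.Cryptography.QubitRegister
import Literature.Computability.QuantumComplexity.PauliExpansion
import Literature.Computability.QuantumComplexity.GaussianRank
import HarnessLib

/-!
# Barrier catalogue `QuantumAdvantage` — a flat Pauli spectrum forces near-maximal initial-block entanglement in every fermionic-Gaussian (matchgate) frame

Topic `Literature/Barriers/QuantumAdvantage` (D-0021). Summit statement:
`QuantumAdvantage := ∃ L, L ∈ BQP ∧ L ∉ BPP`.

One of six entries that file the PROVED bounds of the retired route `SymplecticPurity`
(`Summits/QuantumAdvantage/QuantumAdvantage/Theses/SymplecticPurity.lean`, closed `retired` on the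
human ruling of 2026-08-16) as barrier items: `NoFreeFramePurityBound` (`symplecticPurityBound`,
Clifford frames), `NoFreeFrameGaussianBound` (this file, fact `gaussianDegreeBound`, Gaussian frames),
`NoFreeFrameSBoxSpectrum` (`graphStateSpectrum`), `NoFreeFrameCubeAlmostBent` (`cubeAlmostBent`),
`NoFreeFrameCubeGraphFlat` (`cubeGraphFlat`), `NoFreeFrame` (`noFreeFrame`). The six files are
independent (no mutual imports).

BARRIER: technique_class := classical simulation / compression of quantum states through a FREE
  FERMIONIC frame in a fixed Jordan–Wigner encoding — writing a state as `U · φ` with `U` a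
  fermionic Gaussian unitary (`U c_p U† = Σ_q R_pq c_q`, `R ∈ O(2n)`; these are exactly the
  nearest-neighbour matchgate circuits [cite: JozsaMiyake2008, Thm. 3 and Thm. 5]) and `φ` of low
  entanglement across the initial blocks `{wires < d}`: matchgate- and Clifford+matchgate-augmented
  DMRG [cite: HuangEtAl2025], Gaussian disentanglers, free-fermion ("Gaussianity") resource counting
  [cite: ProjanskyNecaiseWhitfield2024]; matchgate circuits on product inputs are classically
  simulable [cite: JozsaMiyake2008, Thm. 1] [cite: Valiant2002] [cite: TerhalDiVincenzo2004];
  blocks := lowering, by ANY Gaussian re-framing, the Rényi-2 entanglement of the first `d ≤ n`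
  qubits of a unit `ε`-flat state `ψ` (`|⟨ψ|σ_S|ψ⟩| ≤ ε` for all Pauli strings `S ≠ I`) below
  `d − log₂ (1 + ε² Σ_{k=1}^{2d} C(2n, k))`: the purity of the block `{wires < d}` of `U ψ` is
  `≤ 2^{−d} (1 + ε² Σ_{k=1}^{2d} C(2n,k))` (`gaussianDegreeBound`); for a `2^{−δn}`-flat state and
  `d ≤ c(δ)·n` (binary entropy `H(d/n) < δ`, so that `Σ_{k ≤ 2d} C(2n,k) ≤ 2^{2δn}`) the block keeps
  entanglement `≥ d − 1` — no matchgate circuit compresses the almost-bent data states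
  (`cubeGraphFlat`, `2^{1−n/2}`-flat) on their initial blocks;
  because := conjugation by a Gaussian unitary maps the degree-`k` Majorana monomials `c_S`
  (`|S| = k`) among themselves through the `k`-th compound of the orthogonal matrix `R`, which is
  again orthogonal (Cauchy–Binet), starting from `U† c_μ U = Σ_ν R_μν c_ν`
  [cite: JozsaMiyake2008, Thm. 3 (§4: R ∈ SO(2n) for every Gaussian unitary)] — the fact below
  allows any real orthogonal `R`, which only enlarges the frame set; so inside EACH
  Majorana degree the expectation vector of `U ψ` is an isometric image of that of `ψ` and Bessel's
  inequality bounds `Σ_{∅ ≠ S ⊆ first 2d modes} ⟨c_S⟩²_{Uψ} ≤ Σ_{k=1}^{2d} Σ_{|T| = k} ⟨c_T⟩²_ψ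
  ≤ ε² Σ_{k=1}^{2d} C(2n,k)` (each Jordan–Wigner monomial `c_T` is a unit multiple of a non-identity
  Pauli string, hence `|⟨c_T⟩_ψ| ≤ ε`); and the monomials on the first `2d` modes are, up to phase,
  exactly the Pauli strings supported on the first `d` qubits (locality of INITIAL Jordan–Wigner
  blocks), so `Tr ρ_{[d]}² = 2^{−d} Σ_{S ⊆ first 2d modes} ⟨c_S⟩²` [folklore] — machine-checked in
  this tree (see `status`);
  evasions_known := (a) ancilla MODES — with `m` extra fermionic modes the degree count degrades to
  `Σ_j C(2n, k−2j) C(m, j)` and only `2^{Ω(n / log n)}` survives: NOT claimed here (contrast the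
  Clifford entry `symplecticPurityBound`, which is ancilla-robust); (b) NON-INITIAL blocks and other
  wire orders — a Jordan–Wigner string makes a non-initial block non-local in the Majoranas, and
  fermionic SWAPs are Gaussian but qubit permutations are not: only the initial blocks `{wires < d}`
  of the given order are claimed; (c) composite frames Clifford ∘ Gaussian ∘ Clifford
  [cite: HuangEtAl2025] — undecided (the retired route's open crux `CompositeFrameBound`,
  stmt-QuantumAdvantage-10730); Clifford-conjugated matchgates are a genuinely larger class
  [cite: ProjanskyNecaiseWhitfield2024]; (d) non-flat states (free-fermion eigenstates, stabilizer
  states) are untouched; (e) non-Gaussian (interacting) frames: nothing claimed;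
  scope_caveats := (i) `c = majorana n j b` is the tree's Jordan–Wigner convention
  (`Z^{⊗j} ⊗ X/Y ⊗ I^{⊗(n−j−1)}`, `Literature/Computability/QuantumComplexity/GaussianRank.lean`);
  (ii) `R` is real with `R Rᵀ = 1` (both parities allowed, harmless); `star U` is `U⁻¹` because
  `U ∈ unitaryGroup`; (iii) purity is the four-fold agreement sum under `‖·‖`, as in the companion
  entries; (iv) the bound is vacuous once `ε² Σ_{k ≤ 2d} C(2n,k) ≥ 2^d − 1`, in particular for
  `d` near `n`; (v) exact states only;
  status := theorem — MACHINE-CHECKED IN THIS TREE, Summits side: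
  `Summit.QuantumAdvantage.QuantumAdvantage.Theorems.SymplecticPurity.GaussianDegreeBound_proof`
  (files `Summits/QuantumAdvantage/QuantumAdvantage/Theorems/SymplecticPurityGaussianDegreeBound.lean`
  and `…GaussianDegreeBound{Words,Bessel,SpectralMass}.lean`, standard axioms) closed item
  stmt-QuantumAdvantage-9838 of route `SymplecticPurity`; typed below as a NAMED FACT only because
  `Literature` may not import `Summits` (CONVENTIONS §2): the body is token for token the route decl
  `Summit.QuantumAdvantage.QuantumAdvantage.Theses.SymplecticPurity.GaussianDegreeBound`
  (definitionally equal, `Iff.rfl`, and discharged by `exact GaussianDegreeBound_proof` in the filing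
  planner's scratch check, 2026-08-16), so the discharge of record is the ONE-LINE Summits-side
  `theorem gaussianDegreeBound_holds : Literature.Barriers.QuantumAdvantage.gaussianDegreeBound :=
  Summit.QuantumAdvantage.QuantumAdvantage.Theorems.SymplecticPurity.GaussianDegreeBound_proof` — do
  NOT re-prove it in `Literature`. Not located in print as stated (nearest: the compound-matrix action
  [cite: JozsaMiyake2008, Thm. 3]; Gaussianity monotones [cite: ProjanskyNecaiseWhitfield2024]).

## Contents

* `gaussianDegreeBound` — THE BARRIER FACT of this file (the only declaration).

## Design notes

* One named fact, no other declaration (D-0026 / `lint.fact-fanout`). Written inline over `QReg`,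
  `normSq` (`QubitRegister.lean`), `Pauli`, `pauliString` (`PauliExpansion.lean`) and `majorana`
  (`GaussianRank.lean`) exactly as on the route, so that the tree theorem discharges it by `exact`;
  `open scoped Classical` matches the route file's elaboration context.

## References

* [JozsaMiyake2008] R. Jozsa, A. Miyake, *Matchgates and classical simulation of quantum circuits*,
  Proc. R. Soc. A 464 (2008) 3089–3106 (arXiv:0804.4050): Thm. 1, §4 Thm. 3, Thm. 5. Read via
  `lit read arxiv:0804.4050`.
* [Valiant2002] L. Valiant, *Quantum circuits that can be simulated classically in polynomial
  time*, SIAM J. Comput. 31 (2002). [TerhalDiVincenzo2004] B. Terhal, D. DiVincenzo, *Classical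
  simulation of noninteracting-fermion quantum circuits*, Phys. Rev. A 65, 032325.
* [HuangEtAl2025] J. Huang et al., *Augmenting DMRG with matchgates and Clifford circuits*,
  arXiv:2505.08635. [ProjanskyNecaiseWhitfield2024] A. Projansky, J. Necaise, J. Whitfield,
  *Gaussianity and simulability of Cliffords and matchgates*, arXiv:2410.10068.
-/

namespace Literature.Barriers.QuantumAdvantage

open scoped BigOperators Matrix ComplexConjugate Classical
open Literature.Computability.Cryptography Literature.Computability.QuantumComplexity

/-- **Matchgate frames do not compress flat states (initial blocks).** Let `ψ` be a unit vector on
`n` qubits with `|⟨ψ|σ_S|ψ⟩| ≤ ε` for every Pauli string `S ≠ I`, and let `U` be a fermionic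
Gaussian unitary — `U c_p U† = Σ_q R_pq c_q` for a real `R` with `R Rᵀ = 1`, `c = majorana n`
(Jordan–Wigner). Then for every `d ≤ n` the block `{wires < d}` of `U ψ` has purity (four-fold
agreement sum) `≤ (1 + ε² Σ_{k=1}^{2d} C(2n,k)) / 2^d`; so a `2^{−δn}`-flat state keeps Rényi-2
entanglement `≥ d − 1` on every initial block with `Σ_{k ≤ 2d} C(2n,k) ≤ 2^{2δn}`.
- technique_class: free FERMIONIC-GAUSSIAN (matchgate) frame in a fixed Jordan–Wigner encoding +
  low-entanglement remainder (matchgate-augmented DMRG, Gaussian disentanglers)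
- blocks: compressing the initial blocks of an `ε`-flat state by any Gaussian unitary; with
  `cubeGraphFlat` (`ε = 2^{1−n/2}` on `2n` qubits) no matchgate circuit lowers the entanglement of
  the first `d ≤ c·n` qubits of the almost-bent data state below `d − 1`
- because: Gaussian conjugation acts on degree-`k` Majorana monomials by the `k`-th compound of
  `R ∈ O(2n)` (orthogonal again) [cite: JozsaMiyake2008, Thm. 3]; Bessel inside each degree;
  initial Jordan–Wigner blocks are Majorana-local, `Tr ρ_{[d]}² = 2^{−d} Σ_{S ⊆ first 2d modes} ⟨c_S⟩²`
- evasions_known: ancilla modes (count degrades, not claimed); non-initial blocks / other orders;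
  composite Clifford∘Gaussian∘Clifford frames [cite: HuangEtAl2025] (undecided, ex-crux
  `CompositeFrameBound` stmt-QuantumAdvantage-10730); Clifford-conjugated matchgates
  [cite: ProjanskyNecaiseWhitfield2024]; non-flat states
- scope_caveats: tree's JW convention `majorana`; both parities of `R`; exact states; vacuous for
  `d` near `n`
- status: theorem, machine-checked in this tree as
  `Summit.QuantumAdvantage.QuantumAdvantage.Theorems.SymplecticPurity.GaussianDegreeBound_proof`
  (item stmt-QuantumAdvantage-9838, route `SymplecticPurity`, retired 2026-08-16); named fact here
  only because `Literature` does not import `Summits` — body definitionally equal to the route decl,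
  discharge = the one-line Summits-side `gaussianDegreeBound_holds := …GaussianDegreeBound_proof`
[folklore] -/
def gaussianDegreeBound : Prop :=
  ∀ (n : ℕ) (ε : ℝ) (ψ : QReg n → ℂ), normSq ψ = 1 →
    (∀ S : Fin n → Pauli, S ≠ (fun _ => Pauli.I) → ‖star ψ ⬝ᵥ (pauliString S).mulVec ψ‖ ≤ ε) →
    ∀ U : Matrix (QReg n) (QReg n) ℂ, U ∈ Matrix.unitaryGroup (QReg n) ℂ →
      (∃ R : Matrix (Fin n × Bool) (Fin n × Bool) ℝ, R * Rᵀ = 1 ∧ ∀ p : Fin n × Bool,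
        U * majorana n p.1 p.2 * star U = ∑ q : Fin n × Bool, (R p q : ℂ) • majorana n q.1 q.2) →
      ∀ d ≤ n,
        ‖∑ x₁ : QReg n, ∑ x₂ : QReg n, ∑ x₃ : QReg n, ∑ x₄ : QReg n,
          (if (∀ i, d ≤ i.val → x₁ i = x₂ i) ∧ (∀ i, i.val < d → x₂ i = x₃ i) ∧
              (∀ i, d ≤ i.val → x₃ i = x₄ i) ∧ (∀ i, i.val < d → x₄ i = x₁ i) then
            (U.mulVec ψ) x₁ * star ((U.mulVec ψ) x₂) * (U.mulVec ψ) x₃ * star ((U.mulVec ψ) x₄)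
          else 0)‖ ≤ (1 + ε ^ 2 * ∑ k ∈ Finset.Icc 1 (2 * d), ((2 * n).choose k : ℝ)) / 2 ^ d

end Literature.Barriers.QuantumAdvantage
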